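import Summits.CriticalPhenomena.PercolationContinuityZ3.Theorems.PercNearOneGluingNoHeavyLowerTailSahiE3PrincipalMeet
import Mathlib.Tactic.Linarith
import Mathlib.Tactic.Ring
import Mathlib.Tactic.Positivity
import HarnessLib

/-!
# `NoHeavyLowerTail` (crux stmt-CriticalPhenomena-4575), Sahi programme P4 (monotone coupling / transport):
# the JUNTA-INTERSECTION TRANSFER for Sahi's `E₃` — when `A ∩ B` depends only on a block `W` of coordinates,
# `E₃(U, A, B) ≥ 0` on the whole cube follows from three cubic conditions on the block alone

Support file (cell `prim-l12`, seat P4, generation 3; `--supports stmt-CriticalPhenomena-4575`).  No named facts, no sorries,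
no definitions.  Companion of `…SahiE3PrincipalMeet` (the case `W`-block intersection = the single full configuration).

## Statement (`sahiE3_nonneg_of_mul_junta`)

Weighted cube on `W ∪ D` (`W ∩ D = ∅`, `p ∈ [0,1]^ι`); `u, f, g` monotone `{0,1}`-valued (indicators of up-sets `U, A, B`);
JUNTA HYPOTHESIS: `f(Z ∪ T)·g(Z ∪ T) = f(D ∪ T)·g(D ∪ T)` for `Z ⊆ D`, `T ⊆ W` — membership in `A ∩ B` does not depend on
the `D`-coordinates.  Write `f* = f(D ∪ ·)`, `g* = g(D ∪ ·)` (the TOP FIBRE sections, up-sets `A*, B*` of `2^W`),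
`k = f*·g*` (the block event `K`, `A* ∩ B* = K`), `π = E_W k`, `a* = E_W f*`, `b* = E_W g*`.  BLOCK HYPOTHESES, for every
monotone `{0,1}`-valued `t` on configurations (up-set `T`):
* (C3W)  `E₃^W(t, f*, g*) ≥ 0` — Sahi's inequality ON THE BLOCK for the top fibre;
* (TanA) `E₃^W(t, k, g*) ≥ b*·E_W[t·f*·(1 − g*)]`  ("the nested-pair functional of `(K, B*)` pays for `b*·μ(T ∩ A* ∖ K)`");
* (TanB) `E₃^W(t, f*, k) ≥ a*·E_W[t·g*·(1 − f*)]`.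
CONCLUSION: `E₃(u, f, g) = 2E[ufg] + Eu·Ef·Eg − Eu·E[fg] − Ef·E[ug] − Eg·E[uf] ≥ 0` on `W ∪ D`, for EVERY up-set `U`.

(TanA)/(TanB) are themselves instances-in-the-limit of Sahi's conjecture on `|W| + 1` coordinates (add one coordinate `e` with
`p_e = ε`, take `A_ε = K ∪ (X_e ∧ A*)`, `B = B*`, `U = X_e ∧ T`; then `E₃ = ε·[(TanA)-slack + O(ε)]`), so the theorem says:
**Sahi's `C₃` on `m + 1` coordinates implies `C₃` in EVERY dimension for all triples one of whose pairwise intersections depends on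
at most `m` coordinates.**  Census of (TanA)/(TanB) (seat P4 gen 3, exact rationals): all up-sets `K ⊆ A*, B*` of `{0,1}^m` with
`A* ∩ B* = K`, all up-sets `T`: `m ≤ 3` under 8 weight vectors and `m = 4` under `p ≡ ½, ⅕, ⅘, 1/10, 9/10, 1/100, 99/100`
(946 389 `(K,A*,B*,T)` up to symmetry per weight) and two asymmetric vectors (4 657 463 each): 0 violations; the fourth corner
`(π,π)` needed by the interpolation is a THEOREM (Harris on the block, below).

## Proof (fibre-local transport, as in `…SahiE3PrincipalMeet`)

With `a = Ef`, `b = Eg`, `m = E[fg] = π` (junta + Fubini), first-slot linearity gives `E₃(u,f,g) = E[u·dens]`,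
`dens = 2fg + (ab − π) − a·g − b·f`.  Fubini over the fibres `{Z ∪ T : T ⊆ W}`: it suffices that every fibre integral
`E_W[T ↦ u(Z ∪ T)·dens(Z ∪ T)]` is `≥ 0`.  Pointwise `dens(Z ∪ T) ≥ d_{a,b}(T)` where `d_{x,y} = κ(x,y)` on `K`,
`−(y + Cov)` on `A* ∖ K`, `−(x + Cov)` on `B* ∖ K`, `−Cov` elsewhere (`κ = (1−x)(1−y) + 1 − π`, `Cov = π − xy`; the sections
over `Z` lie inside the top sections and the coefficients only grow), so the fibre integral is `≥ Φ_T(a,b)` with `T = U_Z` and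
`Φ_T(x,y) = κ·μ(T∩K) − (y+Cov)μ(T∩A*∖K) − (x+Cov)μ(T∩B*∖K) − Cov·μ(T∖(A*∪B*))` — BILINEAR in `(x,y)`, and
`(a,b) ∈ [π,a*] × [π,b*]`.  Its four corner values are `Φ_T(a*,b*) = E₃^W(t,f*,g*)` (C3W), `Φ_T(π,b*) = E₃^W(t,k,g*) − b*μ(T∩A*∖K)`
(TanA), `Φ_T(a*,π)` (TanB) and `Φ_T(π,π) = (2−π)·[μ(T∩K) − π·μ(T)] + π·μ(T∖(A*∪B*)) ≥ 0` (Harris on the block), so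
`Φ_T(a,b) ≥ 0` by two affine interpolations.  [this work]
-/

noncomputable section

namespace Summit.CriticalPhenomena.PercolationContinuityZ3.Theorems

namespace SahiE3JuntaMeet

open Finset Literature.Probability.Percolation Literature.Probability.Percolation.DecisionTree SahiE3PrincipalMeet

variable {ι : Type*} [DecidableEq ι]

/-- Linearity of the cube expectation against four weighted integrands. [folklore] -/
theorem ED_lin4 (X : Finset ι) (p : ι → ℝ) (v r₁ r₂ r₃ r₄ : Finset ι → ℝ) (c₁ c₂ c₃ c₄ : ℝ) :
    ED X p (fun S => v S * (c₁ * r₁ S + c₂ * r₂ S + c₃ * r₃ S + c₄ * r₄ S))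
      = c₁ * ED X p (fun S => v S * r₁ S) + c₂ * ED X p (fun S => v S * r₂ S)
        + c₃ * ED X p (fun S => v S * r₃ S) + c₄ * ED X p (fun S => v S * r₄ S) := by
  unfold ED
  rw [Finset.mul_sum, Finset.mul_sum, Finset.mul_sum, Finset.mul_sum, ← Finset.sum_add_distrib,
    ← Finset.sum_add_distrib, ← Finset.sum_add_distrib]
  refine Finset.sum_congr rfl fun S _ => ?_
  ring

omit [DecidableEq ι] in
/-- Affine interpolation: a quantity affine along a segment and nonnegative at both ends is nonnegative in between.
[folklore] -/
theorem nonneg_of_affine {d x₀ x₁ x v₀ v₁ v : ℝ} (h₀ : v - v₀ = d * (x - x₀)) (h₁ : v₁ - v = d * (x₁ - x))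
    (hv₀ : 0 ≤ v₀) (hv₁ : 0 ≤ v₁) (hx₀ : x₀ ≤ x) (hx₁ : x ≤ x₁) : 0 ≤ v := by
  rcases le_or_gt 0 d with hd | hd
  · nlinarith [mul_nonneg hd (sub_nonneg.2 hx₀)]
  · nlinarith [mul_nonneg (neg_nonneg.2 hd.le) (sub_nonneg.2 hx₁)]

omit [DecidableEq ι] in
/-- A `{0,1}`-valued function is idempotent. [folklore] -/
theorem mul_self_of_01 {h : Finset ι → ℝ} (h01 : ∀ S, h S = 0 ∨ h S = 1) (S : Finset ι) : h S * h S = h S := by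
  rcases h01 S with h0 | h1
  · rw [h0, mul_zero]
  · rw [h1, mul_one]

omit [DecidableEq ι] in
/-- The pointwise comparison behind the fibre-local transport: at a block configuration whose top-fibre memberships are
`fT, gT ∈ {0,1}` and whose memberships over a lower fibre are `f', g'` (`f'g' = fT·gT`, `f' ≤ fT`, `g' ≤ gT`), the first-slot
density `2f'g' + (ab − π) − a g' − b f'` dominates the top-fibre density at `(a,b)`. [this work] -/
theorem topDensity_le (a b π fT gT f' g' : ℝ) (hfT : fT = 0 ∨ fT = 1) (hgT : gT = 0 ∨ gT = 1)
    (hf' : f' = 0 ∨ f' = 1) (hg' : g' = 0 ∨ g' = 1) (hjun : f' * g' = fT * gT) (hfle : f' ≤ fT) (hgle : g' ≤ gT)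
    (ha : 0 ≤ a) (hb : 0 ≤ b) :
    ((1 - a) * (1 - b) + (1 - π)) * (fT * gT) + (-(b + (π - a * b))) * (fT * (1 - gT))
      + (-(a + (π - a * b))) * (gT * (1 - fT)) + (-(π - a * b)) * ((1 - fT) * (1 - gT))
      ≤ 2 * (f' * g') + (a * b - π) - a * g' - b * f' := by
  rcases hfT with h1 | h1 <;> rcases hgT with h2 | h2 <;> rcases hf' with h3 | h3 <;> rcases hg' with h4 | h4 <;>
    subst h1 h2 h3 h4 <;> nlinarith [hjun, hfle, hgle, ha, hb]

omit [DecidableEq ι] in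
/-- Bilinear interpolation on a box: the top-fibre functional `Φ` is affine in each of its two arguments, so it is
nonnegative on `[π, a*] × [π, b*]` as soon as it is nonnegative at the four corners. [folklore] -/
theorem bilinear_nonneg_of_corners (mK mA mB mN π a b aS bS : ℝ) (Φ : ℝ → ℝ → ℝ)
    (hΦ : ∀ x y, Φ x y = ((1 - x) * (1 - y) + (1 - π)) * mK - (y + (π - x * y)) * mA
      - (x + (π - x * y)) * mB - (π - x * y) * mN)
    (hππ : 0 ≤ Φ π π) (hAπ : 0 ≤ Φ aS π) (hπB : 0 ≤ Φ π bS) (hAB : 0 ≤ Φ aS bS)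
    (hπa : π ≤ a) (haaS : a ≤ aS) (hπb : π ≤ b) (hbbS : b ≤ bS) : 0 ≤ Φ a b := by
  have hxπ : 0 ≤ Φ a π :=
    nonneg_of_affine (d := -(1 - π) * mK + π * mA - (1 - π) * mB + π * mN)
      (x₀ := π) (x₁ := aS) (x := a) (v₀ := Φ π π) (v₁ := Φ aS π)
      (by simp only [hΦ]; ring) (by simp only [hΦ]; ring) hππ hAπ hπa haaS
  have hxB : 0 ≤ Φ a bS :=
    nonneg_of_affine (d := -(1 - bS) * mK + bS * mA - (1 - bS) * mB + bS * mN)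
      (x₀ := π) (x₁ := aS) (x := a) (v₀ := Φ π bS) (v₁ := Φ aS bS)
      (by simp only [hΦ]; ring) (by simp only [hΦ]; ring) hπB hAB hπa haaS
  exact nonneg_of_affine (d := -(1 - a) * mK - (1 - a) * mA + a * mB + a * mN)
      (x₀ := π) (x₁ := bS) (x := b) (v₀ := Φ a π) (v₁ := Φ a bS)
      (by simp only [hΦ]; ring) (by simp only [hΦ]; ring) hxπ hxB hπb hbbS

/-- **Junta-intersection transfer for Sahi's `E₃`.**  On the weighted cube on `W ∪ D` (`W ∩ D = ∅`, `p ∈ [0,1]`), let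
`u, f, g` be monotone `{0,1}`-valued with `f(Z ∪ T)·g(Z ∪ T) = f(D ∪ T)·g(D ∪ T)` for `Z ⊆ D`, `T ⊆ W` (the intersection of the
two events is determined by the block `W`).  If the top-fibre sections `f* = f(D ∪ ·)`, `g* = g(D ∪ ·)`, `k = f*·g*` satisfy, for
every monotone `{0,1}`-valued `t`, (C3W) `E₃^W(t,f*,g*) ≥ 0`, (TanA) `E₃^W(t,k,g*) ≥ E_W g* · E_W[t f* (1−g*)]` and
(TanB) `E₃^W(t,f*,k) ≥ E_W f* · E_W[t g* (1−f*)]`, then `E₃(u,f,g) ≥ 0` on `W ∪ D`.  Proof: fibre-local transport — each fibre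
integral of `u·dens` dominates a bilinear form in `(Ef, Eg) ∈ [π, E_W f*] × [π, E_W g*]` whose corners are (C3W), (TanA), (TanB)
and a Harris inequality on the block. [original; reduction of Sahi 2008 Conj. 5 / Kahn 2022 Conj. 5 for triples with a junta
pairwise intersection to the block] -/
theorem sahiE3_nonneg_of_mul_junta (W D : Finset ι) (hWD : Disjoint W D) {p : ι → ℝ}
    (hp0 : ∀ i, 0 ≤ p i) (hp1 : ∀ i, p i ≤ 1) {u f g : Finset ι → ℝ}
    (hu : ∀ ⦃S T : Finset ι⦄, S ⊆ T → u S ≤ u T) (hu01 : ∀ S, u S = 0 ∨ u S = 1)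
    (hf : ∀ ⦃S T : Finset ι⦄, S ⊆ T → f S ≤ f T) (hf01 : ∀ S, f S = 0 ∨ f S = 1)
    (hg : ∀ ⦃S T : Finset ι⦄, S ⊆ T → g S ≤ g T) (hg01 : ∀ S, g S = 0 ∨ g S = 1)
    (hfg : ∀ Z, Z ⊆ D → ∀ T, T ⊆ W → f (Z ∪ T) * g (Z ∪ T) = f (D ∪ T) * g (D ∪ T))
    (hC3 : ∀ t : Finset ι → ℝ, (∀ ⦃S T : Finset ι⦄, S ⊆ T → t S ≤ t T) → (∀ S, t S = 0 ∨ t S = 1) →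
      0 ≤ 2 * ED W p (fun S => t S * f (D ∪ S) * g (D ∪ S))
          + ED W p t * ED W p (fun S => f (D ∪ S)) * ED W p (fun S => g (D ∪ S))
          - ED W p t * ED W p (fun S => f (D ∪ S) * g (D ∪ S))
          - ED W p (fun S => f (D ∪ S)) * ED W p (fun S => t S * g (D ∪ S))
          - ED W p (fun S => g (D ∪ S)) * ED W p (fun S => t S * f (D ∪ S)))
    (hTanA : ∀ t : Finset ι → ℝ, (∀ ⦃S T : Finset ι⦄, S ⊆ T → t S ≤ t T) → (∀ S, t S = 0 ∨ t S = 1) →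
      ED W p (fun S => g (D ∪ S)) * ED W p (fun S => t S * f (D ∪ S) * (1 - g (D ∪ S)))
        ≤ 2 * ED W p (fun S => t S * (f (D ∪ S) * g (D ∪ S)) * g (D ∪ S))
          + ED W p t * ED W p (fun S => f (D ∪ S) * g (D ∪ S)) * ED W p (fun S => g (D ∪ S))
          - ED W p t * ED W p (fun S => (f (D ∪ S) * g (D ∪ S)) * g (D ∪ S))
          - ED W p (fun S => f (D ∪ S) * g (D ∪ S)) * ED W p (fun S => t S * g (D ∪ S))
          - ED W p (fun S => g (D ∪ S)) * ED W p (fun S => t S * (f (D ∪ S) * g (D ∪ S))))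
    (hTanB : ∀ t : Finset ι → ℝ, (∀ ⦃S T : Finset ι⦄, S ⊆ T → t S ≤ t T) → (∀ S, t S = 0 ∨ t S = 1) →
      ED W p (fun S => f (D ∪ S)) * ED W p (fun S => t S * g (D ∪ S) * (1 - f (D ∪ S)))
        ≤ 2 * ED W p (fun S => t S * f (D ∪ S) * (f (D ∪ S) * g (D ∪ S)))
          + ED W p t * ED W p (fun S => f (D ∪ S)) * ED W p (fun S => f (D ∪ S) * g (D ∪ S))
          - ED W p t * ED W p (fun S => f (D ∪ S) * (f (D ∪ S) * g (D ∪ S)))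
          - ED W p (fun S => f (D ∪ S)) * ED W p (fun S => t S * (f (D ∪ S) * g (D ∪ S)))
          - ED W p (fun S => f (D ∪ S) * g (D ∪ S)) * ED W p (fun S => t S * f (D ∪ S))) :
    0 ≤ 2 * ED (W ∪ D) p (fun S => u S * f S * g S)
          + ED (W ∪ D) p u * ED (W ∪ D) p f * ED (W ∪ D) p g
          - ED (W ∪ D) p u * ED (W ∪ D) p (fun S => f S * g S)
          - ED (W ∪ D) p f * ED (W ∪ D) p (fun S => u S * g S)
          - ED (W ∪ D) p g * ED (W ∪ D) p (fun S => u S * f S) := by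
  have hDW : Disjoint D W := hWD.symm
  -- Fubini over the fibres `{Z ∪ T : T ⊆ W}`, `Z ⊆ D`
  have fub : ∀ φ : Finset ι → ℝ, ED (W ∪ D) p φ = ED D p (fun Z => ED W p (fun T => φ (Z ∪ T))) := fun φ => by
    rw [Finset.union_comm]; exact ED_union D W hDW p φ
  -- pointwise facts on `{0,1}`-valued functions
  have hf0 : ∀ S, 0 ≤ f S := fun S => by rcases hf01 S with h | h <;> norm_num [h]
  have hg0 : ∀ S, 0 ≤ g S := fun S => by rcases hg01 S with h | h <;> norm_num [h]
  have hu0 : ∀ S, 0 ≤ u S := fun S => by rcases hu01 S with h | h <;> norm_num [h]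
  have hf1 : ∀ S, f S ≤ 1 := fun S => by rcases hf01 S with h | h <;> norm_num [h]
  have hg1 : ∀ S, g S ≤ 1 := fun S => by rcases hg01 S with h | h <;> norm_num [h]
  -- opaque abbreviations for the block averages of the top fibre and the global averages
  obtain ⟨π, hπ⟩ : ∃ x : ℝ, x = ED W p (fun S => f (D ∪ S) * g (D ∪ S)) := ⟨_, rfl⟩
  obtain ⟨aS, haS⟩ : ∃ x : ℝ, x = ED W p (fun S => f (D ∪ S)) := ⟨_, rfl⟩
  obtain ⟨bS, hbS⟩ : ∃ x : ℝ, x = ED W p (fun S => g (D ∪ S)) := ⟨_, rfl⟩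
  obtain ⟨a, ha⟩ : ∃ x : ℝ, x = ED (W ∪ D) p f := ⟨_, rfl⟩
  obtain ⟨b, hb⟩ : ∃ x : ℝ, x = ED (W ∪ D) p g := ⟨_, rfl⟩
  rw [← ha, ← hb]
  -- (0) the product integrates to `π` on the whole cube (junta hypothesis + Fubini)
  have hm : ED (W ∪ D) p (fun S => f S * g S) = π := by
    rw [fub, hπ, ← ED_const D p (ED W p (fun S => f (D ∪ S) * g (D ∪ S)))]
    refine ED_congr_sub D p fun Z hZ => ?_
    exact ED_congr_sub W p fun T hT => hfg Z hZ T hT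
  -- (1) Harris on the whole cube; ranges `π ≤ a ≤ a*`, `π ≤ b ≤ b*`
  have ha0 : 0 ≤ a := by rw [ha]; exact ED_nonneg (W ∪ D) hp0 hp1 fun S _ => hf0 S
  have hb0 : 0 ≤ b := by rw [hb]; exact ED_nonneg (W ∪ D) hp0 hp1 fun S _ => hg0 S
  have habπ : a * b ≤ π := by
    have h := ED_mul_ED_le_ED_mul (W ∪ D) hp0 hp1 hf hg
    rw [hm, ← ha, ← hb] at h
    exact h
  have hπa : π ≤ a := by
    rw [ha, ← hm]
    exact ED_mono (W ∪ D) hp0 hp1 fun S _ => (mul_le_mul_of_nonneg_left (hg1 S) (hf0 S)).trans_eq (mul_one _)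
  have hπb : π ≤ b := by
    rw [hb, ← hm]
    exact ED_mono (W ∪ D) hp0 hp1 fun S _ => (mul_le_mul_of_nonneg_right (hf1 S) (hg0 S)).trans_eq (one_mul _)
  have haaS : a ≤ aS := by
    rw [ha, haS, fub, ← ED_const D p (ED W p (fun S => f (D ∪ S)))]
    exact ED_mono D hp0 hp1 fun Z hZ =>
      ED_mono W hp0 hp1 fun T _ => hf (Finset.union_subset_union hZ (Finset.Subset.refl T))
  have hbbS : b ≤ bS := by
    rw [hb, hbS, fub, ← ED_const D p (ED W p (fun S => g (D ∪ S)))]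
    exact ED_mono D hp0 hp1 fun Z hZ =>
      ED_mono W hp0 hp1 fun T _ => hg (Finset.union_subset_union hZ (Finset.Subset.refl T))
  -- (2) first-slot linearity: `E₃(u,f,g) = E[u · dens]`
  obtain ⟨dens, hdens⟩ : ∃ d : Finset ι → ℝ, ∀ S, d S = 2 * (f S * g S) + (a * b - π) - a * g S - b * f S :=
    ⟨_, fun S => rfl⟩
  have hE3 : 2 * ED (W ∪ D) p (fun S => u S * f S * g S) + ED (W ∪ D) p u * a * b
          - ED (W ∪ D) p u * ED (W ∪ D) p (fun S => f S * g S)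
          - a * ED (W ∪ D) p (fun S => u S * g S) - b * ED (W ∪ D) p (fun S => u S * f S)
        = ED (W ∪ D) p (fun S => u S * dens S) := by
    have h' : (fun S => u S * dens S)
        = (fun S => u S * (2 * (f S * g S) + (a * b - π) * 1 + -a * g S + -b * f S)) := by
      funext S; rw [hdens]; ring
    have e0 : ED (W ∪ D) p (fun S => u S * (f S * g S)) = ED (W ∪ D) p (fun S => u S * f S * g S) :=
      ED_congr_sub _ _ fun S _ => by ring
    have e1 : ED (W ∪ D) p (fun S => u S * 1) = ED (W ∪ D) p u := ED_congr_sub _ _ fun S _ => mul_one _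
    rw [h', ED_lin4, hm, e0, e1]
    ring
  rw [hE3, fub]
  refine ED_nonneg D hp0 hp1 fun Z hZ => ?_
  -- (3) the fibre over `Z`
  obtain ⟨uZ, huZ⟩ : ∃ v : Finset ι → ℝ, ∀ T, v T = u (Z ∪ T) := ⟨_, fun T => rfl⟩
  have hgoal : (fun T => (fun S => u S * dens S) (Z ∪ T)) = fun T => uZ T * dens (Z ∪ T) := by
    funext T; rw [huZ]
  rw [hgoal]
  have huZ_mono : ∀ ⦃S T : Finset ι⦄, S ⊆ T → uZ S ≤ uZ T := fun S T hST => by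
    rw [huZ, huZ]; exact hu (Finset.union_subset_union (Finset.Subset.refl Z) hST)
  have huZ01 : ∀ S, uZ S = 0 ∨ uZ S = 1 := fun S => by rw [huZ]; exact hu01 _
  have huZ0 : ∀ S, 0 ≤ uZ S := fun S => by rw [huZ]; exact hu0 _
  -- the four regions of the block cut out by the top-fibre sections
  obtain ⟨rK, hrK⟩ : ∃ r : Finset ι → ℝ, ∀ T, r T = f (D ∪ T) * g (D ∪ T) := ⟨_, fun T => rfl⟩
  obtain ⟨rA, hrA⟩ : ∃ r : Finset ι → ℝ, ∀ T, r T = f (D ∪ T) * (1 - g (D ∪ T)) := ⟨_, fun T => rfl⟩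
  obtain ⟨rB, hrB⟩ : ∃ r : Finset ι → ℝ, ∀ T, r T = g (D ∪ T) * (1 - f (D ∪ T)) := ⟨_, fun T => rfl⟩
  obtain ⟨rN, hrN⟩ : ∃ r : Finset ι → ℝ, ∀ T, r T = (1 - f (D ∪ T)) * (1 - g (D ∪ T)) := ⟨_, fun T => rfl⟩
  obtain ⟨mK, hmK⟩ : ∃ x : ℝ, x = ED W p (fun T => uZ T * rK T) := ⟨_, rfl⟩
  obtain ⟨mA, hmA⟩ : ∃ x : ℝ, x = ED W p (fun T => uZ T * rA T) := ⟨_, rfl⟩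
  obtain ⟨mB, hmB⟩ : ∃ x : ℝ, x = ED W p (fun T => uZ T * rB T) := ⟨_, rfl⟩
  obtain ⟨mN, hmN⟩ : ∃ x : ℝ, x = ED W p (fun T => uZ T * rN T) := ⟨_, rfl⟩
  have hmN0 : 0 ≤ mN := by
    rw [hmN]
    exact ED_nonneg W hp0 hp1 fun T _ => by
      rw [hrN]; exact mul_nonneg (huZ0 T) (mul_nonneg (sub_nonneg.2 (hf1 _)) (sub_nonneg.2 (hg1 _)))
  -- the bilinear top-fibre functional
  obtain ⟨Φ, hΦ⟩ : ∃ Φ : ℝ → ℝ → ℝ, ∀ x y, Φ x y = ((1 - x) * (1 - y) + (1 - π)) * mK - (y + (π - x * y)) * mA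
      - (x + (π - x * y)) * mB - (π - x * y) * mN := ⟨_, fun _ _ => rfl⟩
  -- (4) pointwise: `dens (Z ∪ T)` dominates the top-fibre density at `(a,b)`; hence the fibre integral dominates `Φ a b`
  have hpt : ∀ T, T ⊆ W → uZ T * (((1 - a) * (1 - b) + (1 - π)) * rK T + (-(b + (π - a * b))) * rA T
      + (-(a + (π - a * b))) * rB T + (-(π - a * b)) * rN T) ≤ uZ T * dens (Z ∪ T) := by
    intro T hT
    refine mul_le_mul_of_nonneg_left ?_ (huZ0 T)
    have hjun : f (Z ∪ T) * g (Z ∪ T) = f (D ∪ T) * g (D ∪ T) := hfg Z hZ T hT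
    have hfle : f (Z ∪ T) ≤ f (D ∪ T) := hf (Finset.union_subset_union hZ (Finset.Subset.refl T))
    have hgle : g (Z ∪ T) ≤ g (D ∪ T) := hg (Finset.union_subset_union hZ (Finset.Subset.refl T))
    rw [hrK, hrA, hrB, hrN, hdens]
    exact topDensity_le a b π _ _ _ _ (hf01 _) (hg01 _) (hf01 _) (hg01 _) hjun hfle hgle ha0 hb0
  have hdom : Φ a b ≤ ED W p (fun T => uZ T * dens (Z ∪ T)) := by
    have h := ED_lin4 W p uZ rK rA rB rN ((1 - a) * (1 - b) + (1 - π)) (-(b + (π - a * b)))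
      (-(a + (π - a * b))) (-(π - a * b))
    have hle := ED_mono W hp0 hp1
      (φ := fun T => uZ T * (((1 - a) * (1 - b) + (1 - π)) * rK T + (-(b + (π - a * b))) * rA T
        + (-(a + (π - a * b))) * rB T + (-(π - a * b)) * rN T))
      (ψ := fun T => uZ T * dens (Z ∪ T)) hpt
    rw [h, ← hmK, ← hmA, ← hmB, ← hmN] at hle
    rw [hΦ]
    linarith
  refine le_trans ?_ hdom
  -- (5) region bookkeeping on the block
  have hsum : ED W p uZ = mK + mA + mB + mN := by
    have h := ED_lin4 W p uZ rK rA rB rN 1 1 1 1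
    have h0 : ED W p uZ = ED W p (fun S => uZ S * (1 * rK S + 1 * rA S + 1 * rB S + 1 * rN S)) :=
      ED_congr_sub W p fun S _ => by rw [hrK, hrA, hrB, hrN]; ring
    rw [h0, h, hmK, hmA, hmB, hmN]
    ring
  have hfsum : ED W p (fun T => uZ T * f (D ∪ T)) = mK + mA := by
    rw [hmK, hmA, ← ED_add]
    exact ED_congr_sub W p fun T _ => by rw [hrK, hrA]; ring
  have hgsum : ED W p (fun T => uZ T * g (D ∪ T)) = mK + mB := by
    rw [hmK, hmB, ← ED_add]
    exact ED_congr_sub W p fun T _ => by rw [hrK, hrB]; ring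
  have hk_idem_g : ∀ T, f (D ∪ T) * g (D ∪ T) * g (D ∪ T) = f (D ∪ T) * g (D ∪ T) := fun T => by
    rw [mul_assoc, mul_self_of_01 hg01]
  have hk_idem_f : ∀ T, f (D ∪ T) * (f (D ∪ T) * g (D ∪ T)) = f (D ∪ T) * g (D ∪ T) := fun T => by
    rw [← mul_assoc, mul_self_of_01 hf01]
  -- corner (a*, b*): Sahi on the block for the top fibre
  have hcAB : 0 ≤ Φ aS bS := by
    have h := hC3 uZ huZ_mono huZ01
    have e1 : ED W p (fun S => uZ S * f (D ∪ S) * g (D ∪ S)) = mK := by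
      rw [hmK]; exact ED_congr_sub W p fun T _ => by rw [hrK]; ring
    rw [← hπ, ← haS, ← hbS, e1, hsum, hgsum, hfsum] at h
    rw [hΦ]
    linarith
  -- corner (π, b*): the tangent condition (TanA)
  have hcπB : 0 ≤ Φ π bS := by
    have h := hTanA uZ huZ_mono huZ01
    have e1 : ED W p (fun S => uZ S * f (D ∪ S) * (1 - g (D ∪ S))) = mA := by
      rw [hmA]; exact ED_congr_sub W p fun T _ => by rw [hrA]; ring
    have e2 : ED W p (fun S => uZ S * (f (D ∪ S) * g (D ∪ S)) * g (D ∪ S)) = mK := by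
      rw [hmK]; exact ED_congr_sub W p fun T _ => by rw [hrK, mul_assoc, hk_idem_g T]
    have e3 : ED W p (fun S => f (D ∪ S) * g (D ∪ S) * g (D ∪ S)) = π := by
      rw [hπ]; exact ED_congr_sub W p fun T _ => hk_idem_g T
    have e4 : ED W p (fun S => uZ S * (f (D ∪ S) * g (D ∪ S))) = mK := by
      rw [hmK]; exact ED_congr_sub W p fun T _ => by rw [hrK]
    rw [← hπ, ← hbS, e1, e2, hsum, e3, hgsum, e4] at h
    rw [hΦ]
    linarith
  -- corner (a*, π): the tangent condition (TanB)
  have hcAπ : 0 ≤ Φ aS π := by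
    have h := hTanB uZ huZ_mono huZ01
    have e1 : ED W p (fun S => uZ S * g (D ∪ S) * (1 - f (D ∪ S))) = mB := by
      rw [hmB]; exact ED_congr_sub W p fun T _ => by rw [hrB]; ring
    have e2 : ED W p (fun S => uZ S * f (D ∪ S) * (f (D ∪ S) * g (D ∪ S))) = mK := by
      rw [hmK]; exact ED_congr_sub W p fun T _ => by rw [hrK, mul_assoc, hk_idem_f T]
    have e3 : ED W p (fun S => f (D ∪ S) * (f (D ∪ S) * g (D ∪ S))) = π := by
      rw [hπ]; exact ED_congr_sub W p fun T _ => hk_idem_f T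
    have e4 : ED W p (fun S => uZ S * (f (D ∪ S) * g (D ∪ S))) = mK := by
      rw [hmK]; exact ED_congr_sub W p fun T _ => by rw [hrK]
    rw [← hπ, ← haS, e1, e2, hsum, e3, e4, hfsum] at h
    rw [hΦ]
    linarith
  -- corner (π, π): Harris on the block for `(U_Z, K)`
  have hcππ : 0 ≤ Φ π π := by
    have hrK_mono : ∀ ⦃S T : Finset ι⦄, S ⊆ T → rK S ≤ rK T := fun S T hST => by
      rw [hrK, hrK]
      exact mul_le_mul (hf (Finset.union_subset_union (Finset.Subset.refl D) hST))
        (hg (Finset.union_subset_union (Finset.Subset.refl D) hST)) (hg0 _) (hf0 _)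
    have hrKπ : ED W p rK = π := by rw [hπ]; exact ED_congr_sub W p fun T _ => hrK T
    have hH : ED W p uZ * π ≤ mK := by
      rw [← hrKπ, hmK]
      exact ED_mul_ED_le_ED_mul W hp0 hp1 huZ_mono hrK_mono
    rw [hsum] at hH
    have hπ1 : π ≤ 1 := by
      rw [hπ, ← ED_one W p]
      exact ED_mono W hp0 hp1 fun T _ =>
        (mul_le_mul (hf1 (D ∪ T)) (hg1 (D ∪ T)) (hg0 _) zero_le_one).trans_eq (mul_one _)
    have hπ0 : 0 ≤ π := le_trans (mul_nonneg ha0 hb0) habπ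
    have hΦv : Φ π π = (2 - π) * (mK - (mK + mA + mB + mN) * π) + π * mN := by rw [hΦ]; ring
    rw [hΦv]
    have h2 : 0 ≤ 2 - π := by linarith
    have h3 := mul_nonneg h2 (sub_nonneg.2 hH)
    have h4 := mul_nonneg hπ0 hmN0
    linarith
  -- (6) bilinear interpolation from the four corners
  exact bilinear_nonneg_of_corners mK mA mB mN π a b aS bS Φ hΦ hcππ hcAπ hcπB hcAB hπa haaS hπb hbbS

end SahiE3JuntaMeet

end Summit.CriticalPhenomena.PercolationContinuityZ3.Theorems

end
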